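import Summits.AtomisticToContinuum.HydrodynamicLimit.Theorems.InformationPercolationEngineCollisionRatePreShockFrame
import HarnessLib

/-!
# `InformationPercolationEngine.CollisionRate` (stmt-AtomisticToContinuum-13481): the characterisation `(A) → (ESO-ps ↔ T34p-ps)` IN THE
# PRE-SHOCK, DATA-TIED FRAME, read from the existing item `LanfordEnvelopeR`, with the restrictions from the filed frame — helper file PSE

Helper file (`--supports stmt-AtomisticToContinuum-13481`) of the crux line `Sketch` (lead c10, skeleton `Cruxes/CollisionRate/Lines/Sketch.lean`
v27), companion of `…/Theorems/InformationPercolationEngineCollisionRatePreShockFrame.lean` (RED′-ps, NEC-ps).  It assembles: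

* `stub_collisionRatePreShockCoreEquivalence` — **EQV-ps: `(A) → (ESO-ps ↔ T34p-ps)`** (the two tied directions);
* `evenStatOnePreShock_iff_evenTubeTimeStatProbPreShock_of_lanfordEnvelopeR` — the same from the EXISTING a-priori crux item
  `BGEndpointRigidity.LanfordEnvelopeR` (stmt-AtomisticToContinuum-13677) through the landed bridge BR `stub_marginalEnvelopeLG_of_lanfordEnvelopeR`;
* `evenStatOnePreShock_of_lanfordEnvelopeR_of_evenTubeTimeStatProbPreShock` — **the net transfer in the tied frame,
  `ESO-ps ⇐ LanfordEnvelopeR ∧ T34p-ps`**: what a lead of the RESTATED crux (strategist's `CollisionRatePreShock`, whose body ESO-ps is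
  verbatim) imports on day one — the restated crux is reduced to the existing item 13677 and the tied kinetic core T34p-ps, and is
  EQUIVALENT to the latter modulo the former;
* the restrictions from the filed `∀ τ` frame (weakenings: ignore the Euler-solution binders) — `evenStatOnePreShock_of_collisionRate`
  (`CollisionRate → ESO-ps`, the Theorems-side copy of the strategist's `collisionRatePreShock_of_collisionRate`),
  `evenTubeTimeStatProbPreShock_of_evenTubeTimeStatProb` (`T34p → T34p-ps`) and, by name,
  `evenTubeTimeStatProbPreShock_of_lanfordEnvelopeR_of_collisionRate` (`LanfordEnvelopeR → CollisionRate → T34p-ps`).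

Frame (as in `ChaosClosesEuler`'s conclusion and the sibling restatement `EvenStressEnskogPreShock`): after `σ < σ₀` the binders
`∀ (T : ℝ) (ρ θ : ℝ → T3 → ℝ) (u : ℝ → T3 → V3), IsHardSphereEulerSolution σ T ρ u θ → (∀ t ∈ Ico 0 T, ∀ x, ρ t x * σ ^ 3 < η₀) →`, after the
flow family `TendstoHydroFieldsAt (fun N => localGibbsLaw σ a₀ u₀ θ₀ N (Φ N)) Φ ρ u θ 0 →`, and `τ < T` after `0 < τ`.  No new definitions; no
dynamics is proved; ESO-ps and T34p-ps are OPEN at `t > 0` (Boltzmann–Enskog class for the deterministic flow at fixed `σ`), (A) is the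
frame-free marginal envelope of the sibling files.

References: H. van Beijeren, M. H. Ernst, Physica 68 (1973) 437; P. Résibois, J. Stat. Phys. 19 (1978) 593; H. Spohn, *Large Scale
Dynamics of Interacting Particles* (1991), Part I §2.4, §3; O. E. Lanford, *Time evolution of large classical systems* (1975).
-/

open scoped BigOperators Topology Classical MeasureTheory ProbabilityTheory InnerProductSpace ENNReal
open Filter Set Function MeasureTheory
open Literature.Analysis.FluidPDE Literature.MathematicalPhysics.KineticTheory

namespace Summit.AtomisticToContinuum.HydrodynamicLimit.Theorems.CollisionRate

open Summit.AtomisticToContinuum.HydrodynamicLimit.Theses.InformationPercolationEngine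

noncomputable section

/-- **EQV-ps: `(A) → (ESO-ps ↔ T34p-ps)`.**  Under the marginal envelope (A) of the evolved local Gibbs law, the TIED crux statistic
ESO-ps (verbatim the strategist's `CollisionRatePreShock`: for classical hard-sphere Euler solutions on `[0,T)` with packing below the
threshold and local Gibbs data with the `t = 0` LLN, for `τ < T`, `evenStat σ N (Φ N) τ χ g 1 r` small in `LG`-probability) is EQUIVALENT
to the TIED kinetic core T34p-ps (`evenTubeTimeStat σ N (Φ N) τ χ g Ξ₁ᴸ r κ` small in `LG`-probability, same frame).
`→`: NEC-ps; `←`: RED′-ps. [folklore] -/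
theorem stub_collisionRatePreShockCoreEquivalence :
    (∀ (a₀ θ₀ : T3 → ℝ) (u₀ : T3 → V3), Continuous a₀ → Continuous θ₀ → Continuous u₀ →
      (∀ x, 0 < a₀ x) → (∀ x, 0 < θ₀ x) → ∃ σ₀ : ℝ, 0 < σ₀ ∧ ∀ σ : ℝ, 0 < σ → σ < σ₀ →
      ∀ Φ : (N : ℕ) → HardSphereFlow (Torus.geometry (Fin 3)) (hsDiameter σ N) (N + 1),
      ∀ τ : ℝ, 0 < τ → ∃ C : ℝ, 0 ≤ C ∧ ∃ u : V3, ∃ θ : ℝ, 0 < θ ∧ ∃ N₀ : ℕ, ∀ N : ℕ, N₀ ≤ N →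
      ∀ t ∈ Set.Icc (0 : ℝ) τ,
        (∀ i j : Fin (N + 1), i ≠ j → ∀ f : (T3 × V3) × (T3 × V3) → ℝ≥0∞, Measurable f →
          ∫⁻ z, f ((Φ N).flow t z i, (Φ N).flow t z j) ∂(localGibbsLaw σ a₀ u₀ θ₀ N (Φ N)) ≤
            ENNReal.ofReal C * ∫⁻ q, f q ∂(((volume : Measure T3).prod (gaussMeasure u θ)).prod
              ((volume : Measure T3).prod (gaussMeasure u θ)))) ∧
        (∀ i j k : Fin (N + 1), i ≠ j → i ≠ k → j ≠ k → ∀ f : (T3 × V3) × (T3 × V3) × (T3 × V3) → ℝ≥0∞, Measurable f →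
          ∫⁻ z, f ((Φ N).flow t z i, (Φ N).flow t z j, (Φ N).flow t z k) ∂(localGibbsLaw σ a₀ u₀ θ₀ N (Φ N)) ≤
            ENNReal.ofReal C * ∫⁻ q, f q ∂(((volume : Measure T3).prod (gaussMeasure u θ)).prod
              (((volume : Measure T3).prod (gaussMeasure u θ)).prod ((volume : Measure T3).prod (gaussMeasure u θ)))))) →
    ((∃ η₀ : ℝ, 0 < η₀ ∧ ∀ (a₀ θ₀ : T3 → ℝ) (u₀ : T3 → V3), Continuous a₀ → Continuous θ₀ → Continuous u₀ →
      (∀ x, 0 < a₀ x) → (∀ x, 0 < θ₀ x) → ∃ σ₀ : ℝ, 0 < σ₀ ∧ ∀ σ : ℝ, 0 < σ → σ < σ₀ →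
      ∀ (T : ℝ) (ρ θ : ℝ → T3 → ℝ) (u : ℝ → T3 → V3), IsHardSphereEulerSolution σ T ρ u θ →
      (∀ t ∈ Set.Ico 0 T, ∀ x, ρ t x * σ ^ 3 < η₀) →
      ∀ Φ : (N : ℕ) → HardSphereFlow (Torus.geometry (Fin 3)) (hsDiameter σ N) (N + 1),
      TendstoHydroFieldsAt (fun N => localGibbsLaw σ a₀ u₀ θ₀ N (Φ N)) Φ ρ u θ 0 →
      ∀ τ : ℝ, 0 < τ → τ < T → ∀ χ : ℝ × T3 → ℝ, Continuous χ → ∀ g : ℝ → ℝ, Continuous g →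
      (∀ a, η₀ ≤ a → g a = 0) →
      ∀ η δ : ℝ, 0 < η → 0 < δ → ∃ r₀ : ℝ, 0 < r₀ ∧ ∀ r : ℝ, 0 < r → r < r₀ →
      ∃ N₀ : ℕ, ∀ N : ℕ, N₀ ≤ N →
        localGibbsLaw σ a₀ u₀ θ₀ N (Φ N) {z | η < |evenStat σ N (Φ N) τ χ g (fun _ => 1) r z|}
          ≤ ENNReal.ofReal δ) ↔
    (∃ η₀ : ℝ, 0 < η₀ ∧ ∀ (a₀ θ₀ : T3 → ℝ) (u₀ : T3 → V3), Continuous a₀ → Continuous θ₀ → Continuous u₀ →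
      (∀ x, 0 < a₀ x) → (∀ x, 0 < θ₀ x) → ∃ σ₀ : ℝ, 0 < σ₀ ∧ ∀ σ : ℝ, 0 < σ → σ < σ₀ →
      ∀ (T : ℝ) (ρ θ : ℝ → T3 → ℝ) (u : ℝ → T3 → V3), IsHardSphereEulerSolution σ T ρ u θ →
      (∀ t ∈ Set.Ico 0 T, ∀ x, ρ t x * σ ^ 3 < η₀) →
      ∀ Φ : (N : ℕ) → HardSphereFlow (Torus.geometry (Fin 3)) (hsDiameter σ N) (N + 1),
      TendstoHydroFieldsAt (fun N => localGibbsLaw σ a₀ u₀ θ₀ N (Φ N)) Φ ρ u θ 0 →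
      ∀ τ : ℝ, 0 < τ → τ < T → ∀ χ : ℝ × T3 → ℝ, Continuous χ → ∀ g : ℝ → ℝ, Continuous g →
      (∀ x, η₀ ≤ x → g x = 0) →
      ∀ η δ : ℝ, 0 < η → 0 < δ → ∃ r₀ : ℝ, 0 < r₀ ∧ ∀ r : ℝ, 0 < r → r < r₀ →
      ∃ L₀ : ℝ, ∀ L : ℝ, L₀ ≤ L → ∃ κ₀ : ℝ, 0 < κ₀ ∧ ∀ κ : ℝ, 0 < κ → κ < κ₀ → ∃ N₀ : ℕ, ∀ N : ℕ, N₀ ≤ N →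
        localGibbsLaw σ a₀ u₀ θ₀ N (Φ N)
          {z | η < |evenTubeTimeStat σ N (Φ N) τ χ g (fun q : V3 × V3 × V3 => speedCutoff L ‖q.2.2 - q.2.1‖) r κ z|}
          ≤ ENNReal.ofReal δ)) :=
  fun hA => ⟨stub_evenTubeTimeStatProbPreShock_of_evenStatOnePreShock hA,
    stub_evenStatOnePreShock_of_evenTubeTimeStatProbPreShock hA⟩

/-- **EQV-ps from the EXISTING a-priori item** `BGEndpointRigidity.LanfordEnvelopeR` (stmt-AtomisticToContinuum-13677):
`LanfordEnvelopeR → (ESO-ps ↔ T34p-ps)`, through the landed bridge BR `stub_marginalEnvelopeLG_of_lanfordEnvelopeR`. [folklore] -/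
theorem evenStatOnePreShock_iff_evenTubeTimeStatProbPreShock_of_lanfordEnvelopeR
    (hE : Summit.AtomisticToContinuum.HydrodynamicLimit.Theses.BGEndpointRigidity.LanfordEnvelopeR) :
    (∃ η₀ : ℝ, 0 < η₀ ∧ ∀ (a₀ θ₀ : T3 → ℝ) (u₀ : T3 → V3), Continuous a₀ → Continuous θ₀ → Continuous u₀ →
      (∀ x, 0 < a₀ x) → (∀ x, 0 < θ₀ x) → ∃ σ₀ : ℝ, 0 < σ₀ ∧ ∀ σ : ℝ, 0 < σ → σ < σ₀ →
      ∀ (T : ℝ) (ρ θ : ℝ → T3 → ℝ) (u : ℝ → T3 → V3), IsHardSphereEulerSolution σ T ρ u θ →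
      (∀ t ∈ Set.Ico 0 T, ∀ x, ρ t x * σ ^ 3 < η₀) →
      ∀ Φ : (N : ℕ) → HardSphereFlow (Torus.geometry (Fin 3)) (hsDiameter σ N) (N + 1),
      TendstoHydroFieldsAt (fun N => localGibbsLaw σ a₀ u₀ θ₀ N (Φ N)) Φ ρ u θ 0 →
      ∀ τ : ℝ, 0 < τ → τ < T → ∀ χ : ℝ × T3 → ℝ, Continuous χ → ∀ g : ℝ → ℝ, Continuous g →
      (∀ a, η₀ ≤ a → g a = 0) →
      ∀ η δ : ℝ, 0 < η → 0 < δ → ∃ r₀ : ℝ, 0 < r₀ ∧ ∀ r : ℝ, 0 < r → r < r₀ →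
      ∃ N₀ : ℕ, ∀ N : ℕ, N₀ ≤ N →
        localGibbsLaw σ a₀ u₀ θ₀ N (Φ N) {z | η < |evenStat σ N (Φ N) τ χ g (fun _ => 1) r z|}
          ≤ ENNReal.ofReal δ) ↔
    (∃ η₀ : ℝ, 0 < η₀ ∧ ∀ (a₀ θ₀ : T3 → ℝ) (u₀ : T3 → V3), Continuous a₀ → Continuous θ₀ → Continuous u₀ →
      (∀ x, 0 < a₀ x) → (∀ x, 0 < θ₀ x) → ∃ σ₀ : ℝ, 0 < σ₀ ∧ ∀ σ : ℝ, 0 < σ → σ < σ₀ →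
      ∀ (T : ℝ) (ρ θ : ℝ → T3 → ℝ) (u : ℝ → T3 → V3), IsHardSphereEulerSolution σ T ρ u θ →
      (∀ t ∈ Set.Ico 0 T, ∀ x, ρ t x * σ ^ 3 < η₀) →
      ∀ Φ : (N : ℕ) → HardSphereFlow (Torus.geometry (Fin 3)) (hsDiameter σ N) (N + 1),
      TendstoHydroFieldsAt (fun N => localGibbsLaw σ a₀ u₀ θ₀ N (Φ N)) Φ ρ u θ 0 →
      ∀ τ : ℝ, 0 < τ → τ < T → ∀ χ : ℝ × T3 → ℝ, Continuous χ → ∀ g : ℝ → ℝ, Continuous g →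
      (∀ x, η₀ ≤ x → g x = 0) →
      ∀ η δ : ℝ, 0 < η → 0 < δ → ∃ r₀ : ℝ, 0 < r₀ ∧ ∀ r : ℝ, 0 < r → r < r₀ →
      ∃ L₀ : ℝ, ∀ L : ℝ, L₀ ≤ L → ∃ κ₀ : ℝ, 0 < κ₀ ∧ ∀ κ : ℝ, 0 < κ → κ < κ₀ → ∃ N₀ : ℕ, ∀ N : ℕ, N₀ ≤ N →
        localGibbsLaw σ a₀ u₀ θ₀ N (Φ N)
          {z | η < |evenTubeTimeStat σ N (Φ N) τ χ g (fun q : V3 × V3 × V3 => speedCutoff L ‖q.2.2 - q.2.1‖) r κ z|}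
          ≤ ENNReal.ofReal δ) :=
  stub_collisionRatePreShockCoreEquivalence (stub_marginalEnvelopeLG_of_lanfordEnvelopeR hE)

/-- **`ESO-ps ⇐ LanfordEnvelopeR ∧ T34p-ps` — the net transfer of the line `Sketch` in the pre-shock, data-tied frame.**  The restated
crux (strategist's `CollisionRatePreShock`, body verbatim ESO-ps) from the existing a-priori item stmt-13677 and the tied kinetic core
T34p-ps. [folklore] -/
theorem evenStatOnePreShock_of_lanfordEnvelopeR_of_evenTubeTimeStatProbPreShock
    (hE : Summit.AtomisticToContinuum.HydrodynamicLimit.Theses.BGEndpointRigidity.LanfordEnvelopeR)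
    (hT34p : ∃ η₀ : ℝ, 0 < η₀ ∧ ∀ (a₀ θ₀ : T3 → ℝ) (u₀ : T3 → V3), Continuous a₀ → Continuous θ₀ → Continuous u₀ →
      (∀ x, 0 < a₀ x) → (∀ x, 0 < θ₀ x) → ∃ σ₀ : ℝ, 0 < σ₀ ∧ ∀ σ : ℝ, 0 < σ → σ < σ₀ →
      ∀ (T : ℝ) (ρ θ : ℝ → T3 → ℝ) (u : ℝ → T3 → V3), IsHardSphereEulerSolution σ T ρ u θ →
      (∀ t ∈ Set.Ico 0 T, ∀ x, ρ t x * σ ^ 3 < η₀) →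
      ∀ Φ : (N : ℕ) → HardSphereFlow (Torus.geometry (Fin 3)) (hsDiameter σ N) (N + 1),
      TendstoHydroFieldsAt (fun N => localGibbsLaw σ a₀ u₀ θ₀ N (Φ N)) Φ ρ u θ 0 →
      ∀ τ : ℝ, 0 < τ → τ < T → ∀ χ : ℝ × T3 → ℝ, Continuous χ → ∀ g : ℝ → ℝ, Continuous g →
      (∀ x, η₀ ≤ x → g x = 0) →
      ∀ η δ : ℝ, 0 < η → 0 < δ → ∃ r₀ : ℝ, 0 < r₀ ∧ ∀ r : ℝ, 0 < r → r < r₀ →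
      ∃ L₀ : ℝ, ∀ L : ℝ, L₀ ≤ L → ∃ κ₀ : ℝ, 0 < κ₀ ∧ ∀ κ : ℝ, 0 < κ → κ < κ₀ → ∃ N₀ : ℕ, ∀ N : ℕ, N₀ ≤ N →
        localGibbsLaw σ a₀ u₀ θ₀ N (Φ N)
          {z | η < |evenTubeTimeStat σ N (Φ N) τ χ g (fun q : V3 × V3 × V3 => speedCutoff L ‖q.2.2 - q.2.1‖) r κ z|}
          ≤ ENNReal.ofReal δ) :
    ∃ η₀ : ℝ, 0 < η₀ ∧ ∀ (a₀ θ₀ : T3 → ℝ) (u₀ : T3 → V3), Continuous a₀ → Continuous θ₀ → Continuous u₀ →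
      (∀ x, 0 < a₀ x) → (∀ x, 0 < θ₀ x) → ∃ σ₀ : ℝ, 0 < σ₀ ∧ ∀ σ : ℝ, 0 < σ → σ < σ₀ →
      ∀ (T : ℝ) (ρ θ : ℝ → T3 → ℝ) (u : ℝ → T3 → V3), IsHardSphereEulerSolution σ T ρ u θ →
      (∀ t ∈ Set.Ico 0 T, ∀ x, ρ t x * σ ^ 3 < η₀) →
      ∀ Φ : (N : ℕ) → HardSphereFlow (Torus.geometry (Fin 3)) (hsDiameter σ N) (N + 1),
      TendstoHydroFieldsAt (fun N => localGibbsLaw σ a₀ u₀ θ₀ N (Φ N)) Φ ρ u θ 0 →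
      ∀ τ : ℝ, 0 < τ → τ < T → ∀ χ : ℝ × T3 → ℝ, Continuous χ → ∀ g : ℝ → ℝ, Continuous g →
      (∀ a, η₀ ≤ a → g a = 0) →
      ∀ η δ : ℝ, 0 < η → 0 < δ → ∃ r₀ : ℝ, 0 < r₀ ∧ ∀ r : ℝ, 0 < r → r < r₀ →
      ∃ N₀ : ℕ, ∀ N : ℕ, N₀ ≤ N →
        localGibbsLaw σ a₀ u₀ θ₀ N (Φ N) {z | η < |evenStat σ N (Φ N) τ χ g (fun _ => 1) r z|}
          ≤ ENNReal.ofReal δ :=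
  (evenStatOnePreShock_iff_evenTubeTimeStatProbPreShock_of_lanfordEnvelopeR hE).2 hT34p

/-- **Restriction `CollisionRate → ESO-ps`** (the filed `∀ τ` crux implies its pre-shock, data-tied form: rewrite through the bridge
`collisionRate_iff_evenStat_one` and ignore the Euler-solution binders; Theorems-side copy of the strategist's
`collisionRatePreShock_of_collisionRate`). [folklore] -/
theorem evenStatOnePreShock_of_collisionRate (h : CollisionRate) :
    ∃ η₀ : ℝ, 0 < η₀ ∧ ∀ (a₀ θ₀ : T3 → ℝ) (u₀ : T3 → V3), Continuous a₀ → Continuous θ₀ → Continuous u₀ →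
      (∀ x, 0 < a₀ x) → (∀ x, 0 < θ₀ x) → ∃ σ₀ : ℝ, 0 < σ₀ ∧ ∀ σ : ℝ, 0 < σ → σ < σ₀ →
      ∀ (T : ℝ) (ρ θ : ℝ → T3 → ℝ) (u : ℝ → T3 → V3), IsHardSphereEulerSolution σ T ρ u θ →
      (∀ t ∈ Set.Ico 0 T, ∀ x, ρ t x * σ ^ 3 < η₀) →
      ∀ Φ : (N : ℕ) → HardSphereFlow (Torus.geometry (Fin 3)) (hsDiameter σ N) (N + 1),
      TendstoHydroFieldsAt (fun N => localGibbsLaw σ a₀ u₀ θ₀ N (Φ N)) Φ ρ u θ 0 →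
      ∀ τ : ℝ, 0 < τ → τ < T → ∀ χ : ℝ × T3 → ℝ, Continuous χ → ∀ g : ℝ → ℝ, Continuous g →
      (∀ a, η₀ ≤ a → g a = 0) →
      ∀ η δ : ℝ, 0 < η → 0 < δ → ∃ r₀ : ℝ, 0 < r₀ ∧ ∀ r : ℝ, 0 < r → r < r₀ →
      ∃ N₀ : ℕ, ∀ N : ℕ, N₀ ≤ N →
        localGibbsLaw σ a₀ u₀ θ₀ N (Φ N) {z | η < |evenStat σ N (Φ N) τ χ g (fun _ => 1) r z|}
          ≤ ENNReal.ofReal δ := by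
  rw [collisionRate_iff_evenStat_one] at h
  obtain ⟨η₀, hη₀, H⟩ := h
  refine ⟨η₀, hη₀, fun a₀ θ₀ u₀ ha hθ hu ha0 hθ0 => ?_⟩
  obtain ⟨σ₀, hσ₀, H⟩ := H a₀ θ₀ u₀ ha hθ hu ha0 hθ0
  refine ⟨σ₀, hσ₀, fun σ hσ hσlt T ρ θ u _ _ Φ _ τ hτ _ χ hχ g hg hg0 η δ hη hδ => ?_⟩
  exact H σ hσ hσlt Φ τ hτ χ hχ g hg hg0 η δ hη hδ

/-- **Restriction `T34p → T34p-ps`** (the untied kinetic core implies its pre-shock, data-tied form: ignore the Euler-solution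
binders). [folklore] -/
theorem evenTubeTimeStatProbPreShock_of_evenTubeTimeStatProb
    (h : ∃ η₀ : ℝ, 0 < η₀ ∧ ∀ (a₀ θ₀ : T3 → ℝ) (u₀ : T3 → V3), Continuous a₀ → Continuous θ₀ → Continuous u₀ →
      (∀ x, 0 < a₀ x) → (∀ x, 0 < θ₀ x) → ∃ σ₀ : ℝ, 0 < σ₀ ∧ ∀ σ : ℝ, 0 < σ → σ < σ₀ →
      ∀ Φ : (N : ℕ) → HardSphereFlow (Torus.geometry (Fin 3)) (hsDiameter σ N) (N + 1),
      ∀ τ : ℝ, 0 < τ → ∀ χ : ℝ × T3 → ℝ, Continuous χ → ∀ g : ℝ → ℝ, Continuous g →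
      (∀ x, η₀ ≤ x → g x = 0) →
      ∀ η δ : ℝ, 0 < η → 0 < δ → ∃ r₀ : ℝ, 0 < r₀ ∧ ∀ r : ℝ, 0 < r → r < r₀ →
      ∃ L₀ : ℝ, ∀ L : ℝ, L₀ ≤ L → ∃ κ₀ : ℝ, 0 < κ₀ ∧ ∀ κ : ℝ, 0 < κ → κ < κ₀ → ∃ N₀ : ℕ, ∀ N : ℕ, N₀ ≤ N →
        localGibbsLaw σ a₀ u₀ θ₀ N (Φ N)
          {z | η < |evenTubeTimeStat σ N (Φ N) τ χ g (fun q : V3 × V3 × V3 => speedCutoff L ‖q.2.2 - q.2.1‖) r κ z|}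
          ≤ ENNReal.ofReal δ) :
    ∃ η₀ : ℝ, 0 < η₀ ∧ ∀ (a₀ θ₀ : T3 → ℝ) (u₀ : T3 → V3), Continuous a₀ → Continuous θ₀ → Continuous u₀ →
      (∀ x, 0 < a₀ x) → (∀ x, 0 < θ₀ x) → ∃ σ₀ : ℝ, 0 < σ₀ ∧ ∀ σ : ℝ, 0 < σ → σ < σ₀ →
      ∀ (T : ℝ) (ρ θ : ℝ → T3 → ℝ) (u : ℝ → T3 → V3), IsHardSphereEulerSolution σ T ρ u θ →
      (∀ t ∈ Set.Ico 0 T, ∀ x, ρ t x * σ ^ 3 < η₀) →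
      ∀ Φ : (N : ℕ) → HardSphereFlow (Torus.geometry (Fin 3)) (hsDiameter σ N) (N + 1),
      TendstoHydroFieldsAt (fun N => localGibbsLaw σ a₀ u₀ θ₀ N (Φ N)) Φ ρ u θ 0 →
      ∀ τ : ℝ, 0 < τ → τ < T → ∀ χ : ℝ × T3 → ℝ, Continuous χ → ∀ g : ℝ → ℝ, Continuous g →
      (∀ x, η₀ ≤ x → g x = 0) →
      ∀ η δ : ℝ, 0 < η → 0 < δ → ∃ r₀ : ℝ, 0 < r₀ ∧ ∀ r : ℝ, 0 < r → r < r₀ →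
      ∃ L₀ : ℝ, ∀ L : ℝ, L₀ ≤ L → ∃ κ₀ : ℝ, 0 < κ₀ ∧ ∀ κ : ℝ, 0 < κ → κ < κ₀ → ∃ N₀ : ℕ, ∀ N : ℕ, N₀ ≤ N →
        localGibbsLaw σ a₀ u₀ θ₀ N (Φ N)
          {z | η < |evenTubeTimeStat σ N (Φ N) τ χ g (fun q : V3 × V3 × V3 => speedCutoff L ‖q.2.2 - q.2.1‖) r κ z|}
          ≤ ENNReal.ofReal δ := by
  obtain ⟨η₀, hη₀, H⟩ := h
  refine ⟨η₀, hη₀, fun a₀ θ₀ u₀ ha hθ hu ha0 hθ0 => ?_⟩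
  obtain ⟨σ₀, hσ₀, H⟩ := H a₀ θ₀ u₀ ha hθ hu ha0 hθ0
  refine ⟨σ₀, hσ₀, fun σ hσ hσlt T ρ θ u _ _ Φ _ τ hτ _ χ hχ g hg hg0 η δ hη hδ => ?_⟩
  exact H σ hσ hσlt Φ τ hτ χ hχ g hg hg0 η δ hη hδ

/-- **`LanfordEnvelopeR → CollisionRate → T34p-ps`, by name**: the filed crux and the existing a-priori item give the tied kinetic core
(NEC `evenTubeTimeStatProb_of_marginalEnvelope_of_collisionRate` through BR, then the restriction). [folklore] -/
theorem evenTubeTimeStatProbPreShock_of_lanfordEnvelopeR_of_collisionRate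
    (hE : Summit.AtomisticToContinuum.HydrodynamicLimit.Theses.BGEndpointRigidity.LanfordEnvelopeR) (h : CollisionRate) :
    ∃ η₀ : ℝ, 0 < η₀ ∧ ∀ (a₀ θ₀ : T3 → ℝ) (u₀ : T3 → V3), Continuous a₀ → Continuous θ₀ → Continuous u₀ →
      (∀ x, 0 < a₀ x) → (∀ x, 0 < θ₀ x) → ∃ σ₀ : ℝ, 0 < σ₀ ∧ ∀ σ : ℝ, 0 < σ → σ < σ₀ →
      ∀ (T : ℝ) (ρ θ : ℝ → T3 → ℝ) (u : ℝ → T3 → V3), IsHardSphereEulerSolution σ T ρ u θ →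
      (∀ t ∈ Set.Ico 0 T, ∀ x, ρ t x * σ ^ 3 < η₀) →
      ∀ Φ : (N : ℕ) → HardSphereFlow (Torus.geometry (Fin 3)) (hsDiameter σ N) (N + 1),
      TendstoHydroFieldsAt (fun N => localGibbsLaw σ a₀ u₀ θ₀ N (Φ N)) Φ ρ u θ 0 →
      ∀ τ : ℝ, 0 < τ → τ < T → ∀ χ : ℝ × T3 → ℝ, Continuous χ → ∀ g : ℝ → ℝ, Continuous g →
      (∀ x, η₀ ≤ x → g x = 0) →
      ∀ η δ : ℝ, 0 < η → 0 < δ → ∃ r₀ : ℝ, 0 < r₀ ∧ ∀ r : ℝ, 0 < r → r < r₀ →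
      ∃ L₀ : ℝ, ∀ L : ℝ, L₀ ≤ L → ∃ κ₀ : ℝ, 0 < κ₀ ∧ ∀ κ : ℝ, 0 < κ → κ < κ₀ → ∃ N₀ : ℕ, ∀ N : ℕ, N₀ ≤ N →
        localGibbsLaw σ a₀ u₀ θ₀ N (Φ N)
          {z | η < |evenTubeTimeStat σ N (Φ N) τ χ g (fun q : V3 × V3 × V3 => speedCutoff L ‖q.2.2 - q.2.1‖) r κ z|}
          ≤ ENNReal.ofReal δ :=
  evenTubeTimeStatProbPreShock_of_evenTubeTimeStatProb
    (evenTubeTimeStatProb_of_marginalEnvelope_of_collisionRate (stub_marginalEnvelopeLG_of_lanfordEnvelopeR hE) h)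

end

end Summit.AtomisticToContinuum.HydrodynamicLimit.Theorems.CollisionRate
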